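import Summits.CriticalPhenomena.PercolationContinuityZ3.Theorems.PercNearOneGluingNoHeavyLowerTailMajorityGluingQCert3Count
import HarnessLib

/-!
# Degree-3 certificates checked by KEY RANGES: chunking the kernel's merge sort across several theorems (lane prim-rate, constants-miner 1, gen 34; NEXT-g35 item 1)

Support file for the closed crux `NoHeavyLowerTail` (stmt-CriticalPhenomena-4575), majority-gluing line; companion of `…QCert3` / `…QCert3Sound` / `…QCert3Count`.
A degree-3 certificate for `(6,4)` has `10⁵`–`10⁶` contributions; one `decide +kernel` of `Cert3.checkQ3` would sort them all at once (≈ 180 µs per merge step on the farm).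
Here the check is split by RANGES OF KEYS: `Cert3.rest lo` = the contributions with key `≥ lo`, `Cert3.checkQ3R lo hi fuel` = the run check on the sorted contributions with
`lo ≤ key < hi` — each range is its own closed `decide +kernel` theorem — and `Cert3.evalC_rest_step` chains them: if the range `[lo, hi)` passes and `rest hi` evaluates
nonnegatively then so does `rest lo`; with `rest 0 = contribs` (`rest_zero`) and `rest B = []` for `B` above every key (checked by `decide` in the data file) one gets
`0 ≤ evalC (val3 v) contribs` for every nonnegative `v`, which `Cert3.sound3_of_eval` (the evaluation form of `Cert3.sound3`) and **`cut_of_eval3_count`** turn into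
`cD·μ(h ≤ #cut T) ≤ cN·δ` exactly as `cut_of_check3_count` does.  No sorries. [cite: VandenbergKahn2001, Thm 1.2 (p. 123)]
-/

noncomputable section

namespace Summit.CriticalPhenomena.PercolationContinuityZ3.Theorems

open MeasureTheory Set
open Literature.Probability.LatticeModels (prodBernoulli)
open Literature.Probability.Percolation
open scoped Classical

namespace HubOnly
namespace QCert

namespace Cert3

variable (c : Cert3)

/-- The contributions with key `≥ lo`. -/
def rest (lo : ℕ) : List (ℕ × ℤ) := c.contribs.filter fun e => decide (lo ≤ e.1)

/-- **The range check** on the keys `lo ≤ key < hi`: sort that part and scan its runs. -/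
def checkQ3R (lo hi fuel : ℕ) : Bool := runsOK (msortK fuel ((c.rest lo).filter fun e => decide (e.1 < hi)))

/-- `rest 0` is everything. -/
theorem rest_zero : c.rest 0 = c.contribs := by
  unfold rest; exact List.filter_eq_self.2 fun e _ => by simp

/-- **Range step:** a passing range `[lo, hi)` and a nonnegative remainder `rest hi` give a nonnegative `rest lo`. -/
theorem evalC_rest_step (val : ℕ → ℝ) (hval : ∀ i, 0 ≤ val i) (lo hi fuel : ℕ) (hle : lo ≤ hi) (hR : c.checkQ3R lo hi fuel = true)
    (hrest : 0 ≤ evalC val (c.rest hi)) : 0 ≤ evalC val (c.rest lo) := by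
  have hsplit := evalC_perm val (List.filter_append_perm (fun e : ℕ × ℤ => decide (e.1 < hi)) (c.rest lo))
  rw [evalC_append] at hsplit
  have h1 : 0 ≤ evalC val ((c.rest lo).filter fun e => decide (e.1 < hi)) := evalC_nonneg_of_runsOK_msortK val hval fuel _ hR
  have h2 : (c.rest lo).filter (fun e => !decide (e.1 < hi)) = c.rest hi := by
    unfold rest
    rw [List.filter_filter]
    refine List.filter_congr fun e _ => ?_
    by_cases h : hi ≤ e.1
    · have : lo ≤ e.1 := le_trans hle h
      simp [h, this]
    · simp [h]
  rw [h2] at hsplit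
  linarith

/-- An empty remainder evaluates to `0`. -/
theorem evalC_rest_nil (val : ℕ → ℝ) (B : ℕ) (hB : c.rest B = []) : 0 ≤ evalC val (c.rest B) := by
  rw [hB]; simp [evalC]

/-- **SOUNDNESS, evaluation form:** if `checkW3` passes and the contribution list evaluates nonnegatively at every `val3 v` (e.g. by range checks), then at
every nonnegative point satisfying the marginal, case-chain and row hypotheses, `cD·T(v) ≤ cN·v_D` (the proof of `Cert3.sound3` with the evaluation as hypothesis). -/
theorem sound3_of_eval (hW : c.checkW3 = true) (hQ : ∀ v : ℕ → ℝ, (∀ i, 0 ≤ v i) → 0 ≤ evalC (val3 c.NV v) c.contribs)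
    (v : ℕ → ℝ) (hv : ∀ i, 0 ≤ v i)
    (hmarg : ∀ x < c.base.m, linv c.NV (fun i => Cert.bi (c.base.margMem x i)) v ≤ v c.base.D)
    (hcase : ∀ x, x + 1 < c.base.m →
      linv c.NV (fun i => Cert.bi (c.base.eMem x i)) v ≤ linv c.NV (fun i => Cert.bi (c.base.eMem (x + 1) i)) v)
    (hrows : ∀ ch ∈ c.rows, ∀ r ∈ ch,
      linv c.NV (fun i => Cert.bi (tb r.row.m1 i)) v * linv c.NV (fun i => Cert.bi (tb r.row.m2 i)) v ≤
        linv c.NV (fun i => Cert.bi (tb r.row.m3 i)) v * linv c.NV (fun i => Cert.bi (tb r.row.m4 i)) v) :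
    (c.base.cD : ℝ) * linv c.NV (fun i => Cert.bi (c.base.tMem i)) v ≤ c.base.cN * v c.base.D := by
  obtain ⟨_, hh, hDD, hell, hlin, hrow, hsq⟩ := c.checkW3_spec hW
  -- the whole contribution list is nonnegative at `val3`
  have hpos : 0 ≤ evalC (val3 c.NV v) c.contribs := hQ v hv
  -- split it
  have hsplit : evalC (val3 c.NV v) c.contribs =
      ((c.ell2.map c.ell2C).map (evalC (val3 c.NV v))).sum + ((c.lin3.map c.lin3C).map (evalC (val3 c.NV v))).sum +
      ((c.rows.map fun ch => (ch.map c.row3C).flatten).map (evalC (val3 c.NV v))).sum +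
      ((c.sqs.map fun ch => (ch.map c.sq3C).flatten).map (evalC (val3 c.NV v))).sum := by
    unfold contribs; rw [evalC_append, evalC_append, evalC_append, evalC_flatten, evalC_flatten, evalC_flatten, evalC_flatten]
  -- the four parts
  have h1 : ((c.ell2.map c.ell2C).map (evalC (val3 c.NV v))).sum = c.base.Λ v * c.ell2v v := by
    rw [List.map_map]
    have hc : c.ell2.map (evalC (val3 c.NV v) ∘ c.ell2C) = c.ell2.map (fun e => ((e.2.2 : ℝ) * (v e.1 * v e.2.1)) * c.base.Λ v) :=
      List.map_congr_left fun e he => by rw [Function.comp_apply, c.evalC_ell2C v e (hell e he).1 (hell e he).2]; ring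
    rw [hc, listSum_mul_const, ell2v, mul_comm]
  have h2 : ((c.lin3.map c.lin3C).map (evalC (val3 c.NV v))).sum ≤ 0 := by
    rw [List.map_map]
    refine listSum_nonpos _ _ fun e he => ?_
    obtain ⟨hk, ha, hb⟩ := hlin e he
    rw [Function.comp_apply]
    have hab : 0 ≤ (e.2.2.2.2 : ℝ) * (v e.2.2.1 * v e.2.2.2.1) := mul_nonneg (Nat.cast_nonneg _) (mul_nonneg (hv _) (hv _))
    rcases hk with ⟨hk1, hx⟩ | ⟨hk2, hx⟩
    · rw [c.evalC_lin3C_one v e hk1 ha hb]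
      have := hmarg e.2.1 hx
      nlinarith
    · rw [c.evalC_lin3C_two v e (by omega) ha hb]
      have := hcase e.2.1 hx
      nlinarith
  have h3 : ((c.rows.map fun ch => (ch.map c.row3C).flatten).map (evalC (val3 c.NV v))).sum ≤ 0 := by
    rw [List.map_map]
    refine listSum_nonpos _ _ fun ch hch => ?_
    rw [Function.comp_apply, evalC_flatten, List.map_map]
    refine listSum_nonpos _ _ fun r hr => ?_
    rw [Function.comp_apply, c.evalC_row3C v r (hrow ch hch r hr).2]
    have hr' := hrows ch hch r hr
    have hn : (0 : ℝ) ≤ r.row.n := Nat.cast_nonneg _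
    have hprod := mul_nonneg (mul_nonneg hn (sub_nonneg.2 hr')) (hv r.t)
    linarith
  have h4 : ((c.sqs.map fun ch => (ch.map c.sq3C).flatten).map (evalC (val3 c.NV v))).sum ≤ 0 := by
    rw [List.map_map]
    refine listSum_nonpos _ _ fun ch hch => ?_
    rw [Function.comp_apply, evalC_flatten, List.map_map]
    refine listSum_nonpos _ _ fun s hs => ?_
    rw [Function.comp_apply, c.evalC_sq3C v s (hsq ch hch s hs)]
    have hsqnn := mul_self_nonneg (linv c.NV s.sq.u v)
    have hn : (0 : ℝ) ≤ s.sq.n := Nat.cast_nonneg _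
    have ht : 0 ≤ v s.t := hv _
    have := mul_nonneg (mul_nonneg hn hsqnn) ht
    linarith
  have hmain : 0 ≤ c.base.Λ v * c.ell2v v := by rw [hsplit, h1] at hpos; linarith
  have hell2 := c.ell2DD_mul_le v hv
  rcases eq_or_lt_of_le (hv c.base.D) with hD | hD
  · -- `v_D = 0`
    rw [c.base.tForm_eq_zero hh v hv hmarg hD.symm, ← hD, mul_zero, mul_zero]
  · have hpos2 : 0 < c.ell2v v := lt_of_lt_of_le (mul_pos (by exact_mod_cast hDD) (mul_pos hD hD)) hell2
    have hΛ : 0 ≤ c.base.Λ v := by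
      by_contra hneg
      push Not at hneg
      have := mul_neg_of_neg_of_pos hneg hpos2
      linarith
    unfold Cert.Λ at hΛ
    linarith


end Cert3

variable {n k : ℕ}

section AnyK3R

variable (c : Cert3) (hm : c.base.m = k) (hfam : c.base.fam = 1)
include hm hfam

/-- **«At least `h` of `k` cut» for ANY degree-3 certificate passing `checkW3` whose contribution list evaluates nonnegatively** (e.g. by range checks), counting form.
[cite: VandenbergKahn2001, Thm 1.2 (p. 123)] -/
theorem cut_of_eval3_count (hW : c.checkW3 = true) (hQ : ∀ v : ℕ → ℝ, (∀ i, 0 ≤ v i) → 0 ≤ evalC (val3 c.NV v) c.contribs)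
    (w : Sym2 (Fin n) → unitInterval) (a₀ : Fin n) (T : Finset (Fin n))
    (hT : T.card = k) (δ : ℝ) (hδ0 : 0 ≤ δ) (hδ : ∀ v ∈ T, (prodBernoulli w).real (openConn v a₀ : Set (BondConfig (Fin n)))ᶜ ≤ δ) :
    (c.base.cD : ℝ) * (prodBernoulli w).real {ω : BondConfig (Fin n) | c.base.h ≤ (T.filter fun v => ω ∉ openConn v a₀).card} ≤
      c.base.cN * δ := by
  have hδ' : ∀ x ∈ T, (prodBernoulli w).real (openConn a₀ x : Set (BondConfig (Fin n)))ᶜ ≤ δ := by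
    intro x hx; rw [knThm2_openConn_comm]; exact hδ x hx
  have hset : {ω : BondConfig (Fin n) | c.base.h ≤ (T.filter fun v => ω ∉ openConn v a₀).card} =
      {ω : BondConfig (Fin n) | c.base.h ≤ (T.filter (fun x => ω ∉ (openConn a₀ x : Set (BondConfig (Fin n))))).card} := by
    ext ω
    simp only [mem_setOf_eq]
    rw [Finset.filter_congr (fun v _ => by rw [knThm2_openConn_comm v a₀])]
  rw [hset]
  obtain ⟨t, ht, hTt, hmono⟩ := exists_sorted_enumK T hT (fun v => (prodBernoulli w).real
    ((openConn a₀ v : Set (BondConfig (Fin n))) ∩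
      {ω : BondConfig (Fin n) | c.base.h ≤ (T.filter fun x => ω ∉ (openConn a₀ x : Set (BondConfig (Fin n)))).card}))
  have hδt : ∀ x : Fin k, (prodBernoulli w).real (openConn a₀ (t x) : Set (BondConfig (Fin n)))ᶜ ≤ δ := fun x =>
    hδ' (t x) (by rw [hTt]; exact Finset.mem_image_of_mem _ (Finset.mem_univ _))
  -- the enumerated form (as in `cut_of_check3`)
  have hNV : c.NV = 2 ^ k + 1 := by rw [Cert3.NV, Cert.NV, hm]
  have hD : c.base.D = 2 ^ k := by rw [Cert.D, hm]
  have hv : ∀ i, 0 ≤ lawvK w a₀ t δ i := lawvK_nonneg w a₀ t δ hδ0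
  obtain ⟨_, _, _, _, _, hrows, _⟩ := c.checkW3_spec hW
  have hsound := c.sound3_of_eval hW hQ (lawvK w a₀ t δ) hv
    (by
      intro x hx
      rw [hm] at hx
      rw [hNV, hD, lawvK_D, linv_lawvK _ _ _ _ _ (margMemK_D c.base hm x), setOf_margMemK c.base hm a₀ t ⟨x, hx⟩]
      exact hδt ⟨x, hx⟩)
    (by
      intro x hx
      rw [hm] at hx
      rw [hNV, linv_lawvK _ _ _ _ _ (eMemK_D c.base hm hfam x), linv_lawvK _ _ _ _ _ (eMemK_D c.base hm hfam (x + 1)),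
        setOf_eMemK c.base hm hfam a₀ t ht T hTt ⟨x, by omega⟩, setOf_eMemK c.base hm hfam a₀ t ht T hTt ⟨x + 1, hx⟩]
      exact hmono (Fin.mk_le_mk.2 (by omega)))
    (by
      intro ch hch r hr
      rw [hNV]
      exact row_lawvK c.base hm w a₀ t ht δ r.row (hrows ch hch r hr).1)
  rw [hNV, hD, lawvK_D, linv_lawvK _ _ _ _ _ (tMemK_D c.base hm), setOf_tMemK c.base hm a₀ t ht T hTt] at hsound
  exact hsound

end AnyK3R

end QCert
end HubOnly

end Summit.CriticalPhenomena.PercolationContinuityZ3.Theorems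

end
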